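import Mathlib.Algebra.MvPolynomial.Eval
import Mathlib.Algebra.MvPolynomial.CommRing
import Mathlib.Data.Matrix.Basic
import Mathlib.Data.Matrix.Mul
import Mathlib.LinearAlgebra.Dimension.Finrank
import Mathlib.LinearAlgebra.Quotient.Basic
import Mathlib.Algebra.BigOperators.Finprod
import Mathlib.RingTheory.Polynomial.Cyclotomic.Basic
import Mathlib.RingTheory.RootsOfUnity.PrimitiveRoots
import Mathlib.FieldTheory.Perfect
import Mathlib.Data.ZMod.Basic

/-!
# Vocabulary of line `witt-lift-rigid-mf` of crux `FermatAnchorAssembly` (stmt-HodgeConjecture-14874):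
bigraded matrix factorizations of the Fermat form (CONSTRUCTIVE carriers)

Route `PadicSemiregularLift` of `HodgeConjecture`; crux
`FermatAnchorAssembly := PadicPridhamSemiregularity → FormalLiftingFromClassLifting →
FormalVectorBundlesAlgebraize → HodgeFermatVarieties`. Line `witt-lift-rigid-mf`
(`Cruxes/FermatAnchorAssembly/Ideas/witt-lift-rigid-mf.md`, skeleton `Cruxes/FermatAnchorAssembly/Lines/witt_lift_rigid_mf.lean`,
lead prover-line-stmt-HodgeConjecture-14874-c5-0): lift the MATRIX FACTORIZATION, not the cycle.

This file is the importable home of the line's vocabulary (it was spelled inline in the planner's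
skeleton, generation 1; the registered stubs `stub_readout`, `stub_rigidLift`, `stub_eulerBaseChange`,
`stub_rigidSeeds` are stated over exactly these constants, so that stub files under `Theorems/` and the
skeleton share ONE copy):

* `fermatForm R ν m = Σ_{i<ν} xᵢᵐ`; `zdeg`, `gdeg` (ℤ-degree and `(ℤ/m)^ν`-character of a monomial);
  `IsBihom m L q d c` (every monomial of `q` has degree `d` and character `≡ c (mod L)`);
* `GMFData R ν m ι₀ ι₁` — degree/character labels of the generators of `F⁰`, `F¹` and the two matrices
  `φ : F¹ → F⁰`, `ψ : F⁰ → F¹(m)`; `GMFData.map` (base change), `.shift` (`N[1]`), `.diagTwist`/`.twist`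
  (`g^*N`, `xᵢ ↦ ζ^{gᵢ} xᵢ`), `.cochainSet`/`.closedSet`/`.nullSet` (even cochains of twist `t`, chain maps,
  null-homotopic maps), `.homDim` (`dim Hom(M, N(t))` in the homotopy category, a `finrank`),
  `.eulerForm` (`χ(M,N) = Σⱼ (dim Hom(M,N(jm)) − dim Hom(M,N[1](jm)))`, a `finsum`), `.thetaPoly`
  (the charge polynomial `Θ_{γ,N}(T) = Σ_g χ(N, g^*N)·T^{⟨γ,g⟩}`), `.IsRigid` (`Hom(M, M(m)) = 0`);
* `GMF R ν m L ι₀ ι₁` — LAWFUL `L`-graded factorizations (`extends GMFData`: bihomogeneity + `φψ = ψφ = f·1`);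
* sanity: `isBihom_X_pow_top`, `rankOne` (`x₀ᵃ · x₀ᵐ⁻ᵃ`, lawful over every commutative ring by `simp`);
* witness records `RigidSeed M' γ` (prime `p ∤ M'`, perfect `𝕜 ∋ ζ`, `L ∋ γ`, lawful rigid charged `M`)
  and `CharZeroModel L ι₀ ι₁ γ P` (a field `K ⊇ ℚ`, primitive `ζ`, lawful `N` with `Θ_{γ,N} = P`).

Conventions checked by hand (lead c5, NOTES `## Vocabulary audit`): for lawful `M`, `N` one has
null ⊆ closed (`(uψ_M + φ_N s)φ_M = f u + φ_N s φ_M = φ_N (sφ_M + ψ_N u)`), the bidegrees in `nullSet`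
make `s : F⁰_M → F¹_N(t)`, `u : F¹_M(m) → F⁰_N(t)`, `shift` satisfies `[2] = (m)` (degree labels drop by
`m`), `homDim (m) M M = Hom(M, M[2])` is the obstruction group of the graded lifting problem, and even
cochains `M → N.shift` of twist `t` are the odd cochains `M → N` of twist `t + m` up to the sign `u ↦ −u`
(an isomorphism, so dimensions agree). Nothing here is a hypothesis structure; there is no `sorry` and no
named fact. What is deliberately NOT here: the stub statements and the composition (they stay in the
skeleton), any scheme, `Ext`, crystalline realization or anchor.
-/

-- `Summit.HodgeConjecture.HodgeConjecture.…` is the tree's mandated summit/problem namespace (single-problem summit).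
set_option linter.dupNamespace false

noncomputable section

open Finset

namespace Summit.HodgeConjecture.HodgeConjecture.Cruxes.FermatAnchorAssembly.WittLiftRigidMf

/-! ### Vocabulary I — bigraded matrix factorizations of the Fermat form (constructive) -/

/-- The Fermat form `Σ_{i<ν} xᵢᵐ` over any commutative semiring (for a field `K` and `ν = n + 2` this
is the tree's `fermatPolynomial K n m`, definitionally). [cite: Shioda1979PJA, eq. (1), p. 111] -/
def fermatForm (R : Type) [CommSemiring R] (ν m : ℕ) : MvPolynomial (Fin ν) R :=
  ∑ i : Fin ν, MvPolynomial.X i ^ m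

/-- The `ℤ`-degree `|e| = Σ eᵢ` of an exponent vector. [folklore] -/
def zdeg {ν : ℕ} (e : Fin ν →₀ ℕ) : ℤ := ((∑ i, e i : ℕ) : ℤ)

/-- The `μₘ^ν`-character `e mod m` of the monomial `x^e`. [folklore] -/
def gdeg {ν : ℕ} (m : ℕ) (e : Fin ν →₀ ℕ) : Fin ν → ZMod m := fun i ↦ ((e i : ℕ) : ZMod m)

/-- `q` is BIHOMOGENEOUS of bidegree `(d, c mod L)`: every monomial `x^e` of `q` has `|e| = d` and
`e mod m ≡ c` modulo the subgroup `L ≤ (ℤ/m)^ν` (grading by the characters of `H = L^⊥ ≤ μₘ^ν`;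
`L = ⊤`: no equivariance, `L = ℤγ`: `H = ker γ`). [folklore] -/
def IsBihom {R : Type} [CommSemiring R] {ν : ℕ} (m : ℕ) (L : AddSubgroup (Fin ν → ZMod m))
    (q : MvPolynomial (Fin ν) R) (d : ℤ) (c : Fin ν → ZMod m) : Prop :=
  ∀ e ∈ q.support, zdeg e = d ∧ gdeg m e - c ∈ L

/-- DATA of a graded matrix factorization `F¹ —φ→ F⁰ —ψ→ F¹(m)` of a form in `ν` variables:
`F⁰ = ⊕_{i : ι₀} R(−d₀ i)·χ^{c₀ i}`, `F¹ = ⊕_{j : ι₁} R(−d₁ j)·χ^{c₁ j}` (degree and character labels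
of the generators) and the two matrices (`φ i j` of bidegree `(d₁ j − d₀ i, c₁ j − c₀ i)`, `ψ j i` of
bidegree `(d₀ i + m − d₁ j, c₀ i − c₁ j)`). No axioms here: `map`/`shift`/`twist` act on data.
[cite: BallardFaveroKatzarkov2011, §2 (graded matrix factorizations)] -/
structure GMFData (R : Type) [CommSemiring R] (ν m : ℕ) (ι₀ ι₁ : Type) where
  /-- degrees of the generators of `F⁰` -/
  d₀ : ι₀ → ℤ
  /-- degrees of the generators of `F¹` -/
  d₁ : ι₁ → ℤ
  /-- `μₘ^ν`-characters of the generators of `F⁰` -/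
  c₀ : ι₀ → Fin ν → ZMod m
  /-- `μₘ^ν`-characters of the generators of `F¹` -/
  c₁ : ι₁ → Fin ν → ZMod m
  /-- `φ : F¹ → F⁰` -/
  φ : Matrix ι₀ ι₁ (MvPolynomial (Fin ν) R)
  /-- `ψ : F⁰ → F¹(m)` -/
  ψ : Matrix ι₁ ι₀ (MvPolynomial (Fin ν) R)

namespace GMFData

variable {R : Type} [CommRing R] {ν m : ℕ} {ι₀ ι₁ κ₀ κ₁ : Type}

/-- Base change of the data along a ring map (entrywise on coefficients). [folklore] -/
def map {S : Type} [CommRing S] (g : R →+* S) (M : GMFData R ν m ι₀ ι₁) : GMFData S ν m ι₀ ι₁ where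
  d₀ := M.d₀
  d₁ := M.d₁
  c₀ := M.c₀
  c₁ := M.c₁
  φ := M.φ.map (MvPolynomial.map g)
  ψ := M.ψ.map (MvPolynomial.map g)

/-- The shift `N[1] = (F⁰(… ) ← F¹(m) ← F⁰)`: `F⁰' = F¹(m)`, `F¹' = F⁰`, `φ' = ψ`, `ψ' = φ` (the signs of
the triangulated shift are dropped — an isomorphic factorization). [cite: BallardFaveroKatzarkov2011, §2] -/
def shift (N : GMFData R ν m κ₀ κ₁) : GMFData R ν m κ₁ κ₀ where
  d₀ := fun l ↦ N.d₁ l - m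
  d₁ := N.d₀
  c₀ := N.c₁
  c₁ := N.c₀
  φ := N.ψ
  ψ := N.φ

/-- The diagonal substitution `xᵢ ↦ ζ^{⟨gᵢ⟩} xᵢ` (`ζᵐ = 1` intended: the automorphism `g ∈ μₘ^ν` of
`R[x]` fixing `Σ xᵢᵐ`). [cite: Shioda1979PJA, §4] -/
def diagTwist (ζ : R) (g : Fin ν → ZMod m) : MvPolynomial (Fin ν) R →+* MvPolynomial (Fin ν) R :=
  (MvPolynomial.aeval fun i ↦ MvPolynomial.C (ζ ^ (g i).val) * MvPolynomial.X i).toRingHom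

/-- The pulled-back factorization `g^*N` (entries twisted by `xᵢ ↦ ζ^{⟨gᵢ⟩} xᵢ`; labels unchanged,
as the substitution preserves bidegrees of monomials). [folklore] -/
def twist (ζ : R) (g : Fin ν → ZMod m) (N : GMFData R ν m κ₀ κ₁) : GMFData R ν m κ₀ κ₁ where
  d₀ := N.d₀
  d₁ := N.d₁
  c₀ := N.c₀
  c₁ := N.c₁
  φ := N.φ.map (diagTwist ζ g)
  ψ := N.ψ.map (diagTwist ζ g)

variable (m) in
/-- Even COCHAINS of twist `t` and `L`-degree `0` from `M` to `N`: pairs `(a : F⁰_M → F⁰_N(t),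
b : F¹_M → F¹_N(t))` of bihomogeneous matrices (`a k i` of bidegree `(d₀ᴹ i − d₀ᴺ k + t, c₀ᴹ i − c₀ᴺ k)`,
`b l j` of bidegree `(d₁ᴹ j − d₁ᴺ l + t, c₁ᴹ j − c₁ᴺ l)`). A finite-dimensional space over a field. [folklore] -/
def cochainSet (L : AddSubgroup (Fin ν → ZMod m)) (t : ℤ) (M : GMFData R ν m ι₀ ι₁)
    (N : GMFData R ν m κ₀ κ₁) :
    Set (Matrix κ₀ ι₀ (MvPolynomial (Fin ν) R) × Matrix κ₁ ι₁ (MvPolynomial (Fin ν) R)) :=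
  {ab | (∀ k i, IsBihom m L (ab.1 k i) (M.d₀ i - N.d₀ k + t) (M.c₀ i - N.c₀ k)) ∧
    (∀ l j, IsBihom m L (ab.2 l j) (M.d₁ j - N.d₁ l + t) (M.c₁ j - N.c₁ l))}

variable [Fintype ι₀] [Fintype ι₁] [Fintype κ₀] [Fintype κ₁]

variable (m) in
/-- CLOSED even cochains (chain maps `M → N(t)`): `a φ_M = φ_N b` and `ψ_N a = b ψ_M`. [folklore] -/
def closedSet (L : AddSubgroup (Fin ν → ZMod m)) (t : ℤ) (M : GMFData R ν m ι₀ ι₁)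
    (N : GMFData R ν m κ₀ κ₁) :
    Set (Matrix κ₀ ι₀ (MvPolynomial (Fin ν) R) × Matrix κ₁ ι₁ (MvPolynomial (Fin ν) R)) :=
  {ab | ab ∈ cochainSet m L t M N ∧ ab.1 * M.φ = N.φ * ab.2 ∧ N.ψ * ab.1 = ab.2 * M.ψ}

variable (m) in
/-- NULL-HOMOTOPIC even cochains: `a = u ψ_M + φ_N s`, `b = s φ_M + ψ_N u` for bihomogeneous
`s : F⁰_M → F¹_N(t)`, `u : F¹_M(m) → F⁰_N(t)` of `L`-degree `0`. [folklore] -/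
def nullSet (L : AddSubgroup (Fin ν → ZMod m)) (t : ℤ) (M : GMFData R ν m ι₀ ι₁)
    (N : GMFData R ν m κ₀ κ₁) :
    Set (Matrix κ₀ ι₀ (MvPolynomial (Fin ν) R) × Matrix κ₁ ι₁ (MvPolynomial (Fin ν) R)) :=
  {ab | ∃ (s : Matrix κ₁ ι₀ (MvPolynomial (Fin ν) R)) (u : Matrix κ₀ ι₁ (MvPolynomial (Fin ν) R)),
    (∀ l i, IsBihom m L (s l i) (M.d₀ i - N.d₁ l + t) (M.c₀ i - N.c₁ l)) ∧
    (∀ k j, IsBihom m L (u k j) (M.d₁ j - m - N.d₀ k + t) (M.c₁ j - N.c₀ k)) ∧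
    ab.1 = u * M.ψ + N.φ * s ∧ ab.2 = s * M.φ + N.ψ * u}

/-- `dim_K Hom_{HMF^{gr,L}}(M, N(t))` — closed even cochains of twist `t` modulo null-homotopic ones,
as a `finrank` over the field `K` (the spans are the sets themselves, which are subspaces; for lawful
`M`, `N` null ⊆ closed). Junk value `0` never occurs: the cochain spaces are finite-dimensional by the
degree constraints. [cite: BallardFaveroKatzarkov2011, §2 (morphisms in the homotopy category of graded MFs)] -/
def homDim (K : Type) [Field K] (L : AddSubgroup (Fin ν → ZMod m)) (t : ℤ) (M : GMFData K ν m ι₀ ι₁)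
    (N : GMFData K ν m κ₀ κ₁) : ℕ :=
  Module.finrank K
    (↥(Submodule.span K (closedSet m L t M N)) ⧸
      Submodule.comap (Submodule.span K (closedSet m L t M N)).subtype (Submodule.span K (nullSet m L t M N)))

/-- The EULER FORM of the `ℤ`-graded category `HMF^{gr,L}`:
`χ(M, N) = Σ_{i ∈ ℤ} (−1)ⁱ dim Hom(M, N[i]) = Σ_{j ∈ ℤ} (dim Hom(M, N(jm)) − dim Hom(M, N[1](jm)))`
(`[2] = (m)`), a `finsum` — finite support for factorizations of a form with isolated singularity
(graded stable `Ext` has finite length); junk `0` otherwise. By Hirzebruch–Riemann–Roch for the smooth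
proper dg category `HMF^gr` it is `⟨ch M, ch N⟩` (Polishchuk–Vaintrob; Shklyarov).
[cite: PolishchukVaintrob2012, Thm. 1.3.1 (HRR for matrix factorizations)] -/
def eulerForm (K : Type) [Field K] (L : AddSubgroup (Fin ν → ZMod m)) (M : GMFData K ν m ι₀ ι₁)
    (N : GMFData K ν m κ₀ κ₁) : ℤ :=
  ∑ᶠ j : ℤ, ((homDim K L (j * m) M N : ℤ) - (homDim K L (j * m) M N.shift : ℤ))

/-- The CHARGE POLYNOMIAL `Θ_{γ,N}(T) = Σ_{g ∈ (ℤ/m)^ν} χ(N, g^*N) · T^{⟨Σ γᵢ gᵢ⟩} ∈ ℤ[T]`; its value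
at a primitive `m`-th root of unity is `Σ_{g ∈ μₘ^ν} γ(g) χ(N, g^*N) = mᵛ · ⟨ch(N)_γ, ch(N)_{γ̄}⟩`
(isotypic decomposition of the `μₘ^ν`-invariant Mukai pairing), and it does not depend on the
primitive root `ζ` used to let `(ℤ/m)^ν` act (reindex `g ↦ ug`). [folklore] -/
def thetaPoly (K : Type) [Field K] [NeZero m] (L : AddSubgroup (Fin ν → ZMod m)) (ζ : K)
    (γ : Fin ν → ZMod m) (N : GMFData K ν m κ₀ κ₁) : Polynomial ℤ :=
  ∑ g : Fin ν → ZMod m, Polynomial.monomial (∑ i, γ i * g i).val (eulerForm K L N (N.twist ζ g))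

/-- `M` is RIGID (in `HMF^{gr,L}`): `Hom(M, M(m)) = Hom(M, M[2]) = 0` in `L`-degree `0` — the
obstruction group of the `L`-graded lifting problem `𝕎ⱼ → 𝕎ⱼ₊₁` vanishes. [cite: Ile2004, §2 (obstructions for deforming MCM modules lie in Ext²)] -/
def IsRigid (K : Type) [Field K] (L : AddSubgroup (Fin ν → ZMod m)) (M : GMFData K ν m ι₀ ι₁) : Prop :=
  homDim K L (m : ℤ) M M = 0

end GMFData

/-- A (lawful) `L`-GRADED MATRIX FACTORIZATION OF THE FERMAT FORM `Σ_{i<ν} xᵢᵐ` over `R`: bihomogeneous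
matrices of the prescribed bidegrees with `φ ψ = f · 1`, `ψ φ = f · 1`. For `L ∋ γ` these are the
`ker γ`-equivariant graded factorizations (BFK's factorizations graded by the intermediate group
between the maximal grading and `ℤ`). [cite: BallardFaveroKatzarkov2011, §2 and §10.3 (changing the grading group)] -/
structure GMF (R : Type) [CommRing R] (ν m : ℕ) (L : AddSubgroup (Fin ν → ZMod m)) (ι₀ ι₁ : Type)
    [Fintype ι₀] [Fintype ι₁] [DecidableEq ι₀] [DecidableEq ι₁] extends GMFData R ν m ι₀ ι₁ where
  /-- `φ i j` is bihomogeneous of bidegree `(d₁ j − d₀ i, c₁ j − c₀ i)` -/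
  φ_bihom : ∀ i j, IsBihom m L (φ i j) (d₁ j - d₀ i) (c₁ j - c₀ i)
  /-- `ψ j i` is bihomogeneous of bidegree `(d₀ i + m − d₁ j, c₀ i − c₁ j)` -/
  ψ_bihom : ∀ j i, IsBihom m L (ψ j i) (d₀ i + m - d₁ j) (c₀ i - c₁ j)
  /-- `φ ψ = (Σ xᵢᵐ) · 1` -/
  φ_mul_ψ : φ * ψ = fermatForm R ν m • (1 : Matrix ι₀ ι₀ (MvPolynomial (Fin ν) R))
  /-- `ψ φ = (Σ xᵢᵐ) · 1` -/
  ψ_mul_φ : ψ * φ = fermatForm R ν m • (1 : Matrix ι₁ ι₁ (MvPolynomial (Fin ν) R))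

/-! ### Sanity: the vocabulary is inhabited and computes -/

/-- Monomials are bihomogeneous (trivial grading subgroup). [folklore] -/
theorem isBihom_X_pow_top {R : Type} [CommSemiring R] {ν m : ℕ} (i : Fin ν) (a : ℕ)
    (c : Fin ν → ZMod m) : IsBihom m ⊤ (MvPolynomial.X (R := R) i ^ a) (a : ℤ) c := by
  intro e he
  refine ⟨?_, AddSubgroup.mem_top _⟩
  classical
  rw [MvPolynomial.X_pow_eq_monomial, MvPolynomial.support_monomial] at he
  split_ifs at he with h
  · simp at he
  · simp only [Finset.mem_singleton] at he
    subst he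
    simp [zdeg, Finsupp.single_apply]

/-- **The rank-one factorization `x₀ᵃ · x₀ᵐ⁻ᵃ = x₀ᵐ` of the one-variable Fermat form** as a lawful
`GMF R 1 m ⊤ Unit Unit` over ANY commutative ring (so also over `𝕎 𝕜`): the structure is inhabited
and its axioms compute by `simp`. (It is neither rigid nor charged — no claim is made; the charged
rigid objects of `stub_rigidSeeds` are the open content.) [folklore] -/
def rankOne (R : Type) [CommRing R] (m a : ℕ) (ha : a ≤ m) : GMF R 1 m ⊤ Unit Unit where
  d₀ := fun _ ↦ 0
  d₁ := fun _ ↦ a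
  c₀ := fun _ ↦ 0
  c₁ := fun _ _ ↦ (a : ZMod m)
  φ := Matrix.of fun _ _ ↦ MvPolynomial.X 0 ^ a
  ψ := Matrix.of fun _ _ ↦ MvPolynomial.X 0 ^ (m - a)
  φ_bihom := fun i j ↦ by
    simpa using isBihom_X_pow_top (R := R) (m := m) (0 : Fin 1) a (fun _ ↦ (a : ZMod m))
  ψ_bihom := fun j i ↦ by
    have key := isBihom_X_pow_top (R := R) (m := m) (0 : Fin 1) (m - a) (-fun _ ↦ (a : ZMod m))
    rw [Nat.cast_sub ha] at key
    simpa using key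
  φ_mul_ψ := by
    ext i j
    simp [Matrix.mul_apply, fermatForm, ← pow_add, Nat.add_sub_cancel' ha]
  ψ_mul_φ := by
    ext i j
    simp [Matrix.mul_apply, fermatForm, ← pow_add, Nat.sub_add_cancel ha]

/-- **Sanity sub-goal (the shape of `stub_rigidLift`'s conclusion on the inhabited object): base change
commutes with `rankOne`** — along any ring map `g : R →+* S` the data of the rank-one factorization over `R`
maps to the data of the rank-one factorization over `S` (same labels; `xᵃ ↦ xᵃ`). In particular the
rank-one factorization over a perfect field `𝕜` is the reduction of the one over `𝕎 𝕜`. [folklore] -/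
theorem rankOne_map : ∀ (R S : Type) [CommRing R] [CommRing S] (g : R →+* S) (m a : ℕ) (ha : a ≤ m),
    (rankOne R m a ha).toGMFData.map g = (rankOne S m a ha).toGMFData := by
  intro R S _ _ g m a ha
  simp only [GMFData.map, rankOne]
  congr 1 <;> ext i j <;> simp [Matrix.map_apply, MvPolynomial.map_X]

/-! ### Vocabulary II — witness records (bundling a field with its instances under one `∃`) -/

/-- A RIGID CHARGED SEED for the character `γ` of level `M'`: a prime `p ∤ M'`, a perfect field `𝕜` of
characteristic `p` with a primitive `M'`-th root of unity `ζ`, a grading subgroup `L ∋ γ`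
(`H = L^⊥ ⊆ ker γ`), and a lawful `L`-graded matrix factorization `M` of `Σ xᵢ^{M'}` over `𝕜` which is
RIGID and whose charge polynomial is NOT divisible by the `M'`-th cyclotomic polynomial
(`Θ_γ(M) ≠ 0`). Every field is decidable data over a finite field in the intended instances
(`𝕜 = 𝔽_{q²}`, `M' ∣ q + 1`). [folklore] -/
structure RigidSeed (M' : ℕ) [NeZero M'] {ν : ℕ} (γ : Fin ν → ZMod M') where
  /-- the residue characteristic -/
  p : ℕ
  [prime : Fact p.Prime]
  /-- `p ∤ M'` (isolated singularity on both fibres; `μ_{M'} ⊂ 𝕜̄`) -/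
  not_dvd : ¬ p ∣ M'
  /-- the perfect ground field of characteristic `p` -/
  𝕜 : Type
  [field : Field 𝕜]
  [charP : CharP 𝕜 p]
  [perfect : PerfectRing 𝕜 p]
  /-- a primitive `M'`-th root of unity in `𝕜` -/
  ζ : 𝕜
  prim : IsPrimitiveRoot ζ M'
  /-- index types of the generators of `F⁰`, `F¹` -/
  ι₀ : Type
  ι₁ : Type
  [fin₀ : Fintype ι₀]
  [fin₁ : Fintype ι₁]
  [dec₀ : DecidableEq ι₀]
  [dec₁ : DecidableEq ι₁]
  /-- the grading subgroup, containing `γ` -/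
  L : AddSubgroup (Fin ν → ZMod M')
  mem : γ ∈ L
  /-- the factorization -/
  M : GMF 𝕜 ν M' L ι₀ ι₁
  /-- rigidity: `Hom(M, M(M'))^{L-deg 0} = 0` -/
  rigid : GMFData.IsRigid 𝕜 L M.toGMFData
  /-- charge: `Φ_{M'} ∤ Θ_{γ,M}` -/
  charged : ¬ (Polynomial.cyclotomic M' ℤ ∣ GMFData.thetaPoly 𝕜 L ζ γ M.toGMFData)

/-- A CHARACTERISTIC-ZERO MODEL with prescribed charge polynomial `P`: a field `K ⊇ ℚ` with a primitive
`M'`-th root `ζ`, and a lawful `L`-graded factorization `N` over `K` with `Θ_{γ,N} = P`. [folklore] -/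
structure CharZeroModel {ν M' : ℕ} [NeZero M'] (L : AddSubgroup (Fin ν → ZMod M')) (ι₀ ι₁ : Type)
    [Fintype ι₀] [Fintype ι₁] [DecidableEq ι₀] [DecidableEq ι₁] (γ : Fin ν → ZMod M')
    (P : Polynomial ℤ) where
  /-- the field of characteristic zero -/
  K : Type
  [field : Field K]
  [charZero : CharZero K]
  /-- a primitive `M'`-th root of unity in `K` -/
  ζ : K
  prim : IsPrimitiveRoot ζ M'
  /-- the factorization over `K` -/
  N : GMF K ν M' L ι₀ ι₁
  /-- its charge polynomial is `P` -/
  theta_eq : GMFData.thetaPoly K L ζ γ N.toGMFData = P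

end Summit.HodgeConjecture.HodgeConjecture.Cruxes.FermatAnchorAssembly.WittLiftRigidMf

end
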